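import Summits.QuantumFields.YangMills.Theorems.ColdStartUniversalityLatticeLangevinDiscreteSampling
import HarnessLib

/-!
# Route `ColdStartUniversality` (fixed-cut-off SZZ dynamics): ★★★ ALMOST SURELY, THE EMPIRICAL MEASURE OF THE DISCRETE SAMPLES OF A SINGLE
# COLD-START RUN CONVERGES WEAKLY TO THE WILSON–GIBBS MEASURE — `N⁻¹Σ_(k<N) f(U_(kh)) → ∫ f dμ_(β')` for ALL continuous `f` simultaneously, a.s.

Helper file (seat `ym-line-csu-p1`, g33; `--supports stmt-QuantumFields-24809`).  Discrete-sampling analogue of `…EmpiricalMeasure` (continuous time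
averages): file 54 (`ae_tendsto_average_wilson`) gives a.s. convergence of `N⁻¹Σ_(k<N) G(U_(kh))` for EACH bounded measurable `G`; separability of
`C(SU(2)^E, ℝ)` and the `1`-Lipschitz dependence of sample averages on the observable (sup norm) unite the null sets: for EVERY strong solution of the
SU(2) SZZ dynamics from a deterministic start on ANY probability space, every step `h > 0` (every coupling),
* ★★★ `ae_tendsto_average_forall_continuousMap` — almost surely, for EVERY `f ∈ C(SU(2)^E, ℝ)`, `N⁻¹ Σ_(k<N) f(U_(kh)) → ∫ f dμ_(β')`: the empirical
  measures `N⁻¹Σ_(k<N) δ_(U_(kh))` of the samples of one run (what a simulation histograms) converge weakly to `μ_(β')`, almost surely.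
THEOREMS ONLY, no definition, no sorry; [folklore].  HONEST FRAMING: fixed cut-off; `UniformColdStartMixing` (24809) is NOT restated; no crux, rung or
summit statement is proved; the Yang–Mills mass gap is NOT proved.
-/

set_option autoImplicit false

noncomputable section

namespace Summit.QuantumFields.YangMills.Theorems.ColdStartUniversality

open MeasureTheory ProbabilityTheory Filter Topology
open scoped NNReal ENNReal BigOperators
open Literature Literature.Probability.Process Literature.MathematicalPhysics.QuantumFieldTheory
open Literature.MathematicalPhysics.QuantumLattice (fundamentalRep fundamentalLatticeRep continuous_fundamentalRep)

variable {L : ℕ} [NeZero L]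

/-- ★★★ **Almost-sure weak convergence of the empirical measures of the discrete samples.**  For every strong solution `U` of the SU(2) SZZ
dynamics from a deterministic start on any space and every step `h > 0`: almost surely, for EVERY continuous `f : SU(2)^E → ℝ`,
`N⁻¹ Σ_(k<N) f(U_(kh)) → ∫ f dμ_(β')` as `N → ∞`. [folklore] -/
theorem ae_tendsto_average_forall_continuousMap (L : ℕ) [NeZero L] (β' : ℝ)
    (x : GaugeConfig 3 L (Matrix.specialUnitaryGroup (Fin 2) ℂ))
    {Ω : Type} [MeasurableSpace Ω] {P : Measure Ω} [IsProbabilityMeasure P]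
    {W : ℝ≥0 → Ω → (Edge 3 L × NoiseIdx 2 → ℝ)} (hW : IsFlatBrownian W P)
    {U : ℝ≥0 → Ω → GaugeConfig 3 L (Matrix.specialUnitaryGroup (Fin 2) ℂ)} (hU0 : ∀ ω, U 0 ω = x)
    (hU : (latticeLangevinDynamics (fundamentalLatticeRep 2) β').IsSolution (fundamentalRep (Fin 2)) hW.natFiltration P W U)
    {h : ℝ≥0} (hh : 0 < h) :
    ∀ᵐ ω ∂P, ∀ f : C(GaugeConfig 3 L (Matrix.specialUnitaryGroup (Fin 2) ℂ), ℝ),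
      Tendsto (fun N : ℕ => (N : ℝ)⁻¹ * ∑ k ∈ Finset.range N, f (U ((k : ℝ≥0) * h) ω)) atTop
        (𝓝 (∫ z, f z ∂(wilsonMeasure (d := 3) (L := L) (fundamentalRep (Fin 2)) β'))) := by
  classical
  haveI := secondCountableTopology_su2
  haveI := borelSpace_config L
  haveI : IsProbabilityMeasure (wilsonMeasure (d := 3) (L := L) (fundamentalRep (Fin 2)) β') :=
    isProbabilityMeasure_wilsonMeasure (d := 3) (L := L) (fundamentalRep (Fin 2)) (continuous_fundamentalRep (Fin 2)) β'
  set μ : Measure (GaugeConfig 3 L (Matrix.specialUnitaryGroup (Fin 2) ℂ)) := wilsonMeasure (d := 3) (L := L) (fundamentalRep (Fin 2)) β' with hμ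
  obtain ⟨D, hDc, hDd⟩ := TopologicalSpace.exists_countable_dense C(GaugeConfig 3 L (Matrix.specialUnitaryGroup (Fin 2) ℂ), ℝ)
  have hD : ∀ᵐ ω ∂P, ∀ g ∈ D, Tendsto (fun N : ℕ => (N : ℝ)⁻¹ * ∑ k ∈ Finset.range N, g (U ((k : ℝ≥0) * h) ω)) atTop (𝓝 (∫ z, g z ∂μ)) := by
    rw [ae_ball_iff hDc]
    intro g _
    -- rescale `g` to `|g/C| ≤ 1`, apply file 54, scale back
    set C' : ℝ := max ‖g‖ 1 with hC'
    have hC'0 : 0 < C' := lt_of_lt_of_le one_pos (le_max_right _ _)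
    have hg1 : ∀ z, |g z / C'| ≤ 1 := fun z => by
      rw [abs_div, abs_of_pos hC'0, div_le_one hC'0]
      exact (by simpa [Real.norm_eq_abs] using g.norm_coe_le_norm z : |g z| ≤ ‖g‖).trans (le_max_left _ _)
    have h54 := ae_tendsto_average_wilson L β' x hW hU0 hU (g.continuous.measurable.div_const C') hg1 hh
    filter_upwards [h54] with ω hω
    have h2 := hω.const_mul C'
    have hscale : C' * ∫ z, g z / C' ∂μ = ∫ z, g z ∂μ := by rw [integral_div, mul_div_cancel₀ _ hC'0.ne']
    rw [hscale] at h2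
    refine h2.congr fun N => ?_
    rw [← mul_assoc, mul_comm C', mul_assoc, Finset.mul_sum]
    congr 1
    exact Finset.sum_congr rfl fun k _ => by field_simp
  filter_upwards [hD] with ω hωD f
  -- sample averages are `1`-Lipschitz in the sup norm
  have havg : ∀ (g g' : C(GaugeConfig 3 L (Matrix.specialUnitaryGroup (Fin 2) ℂ), ℝ)) (N : ℕ), 1 ≤ N →
      |((N : ℝ)⁻¹ * ∑ k ∈ Finset.range N, g (U ((k : ℝ≥0) * h) ω)) - (N : ℝ)⁻¹ * ∑ k ∈ Finset.range N, g' (U ((k : ℝ≥0) * h) ω)| ≤ dist g g' := by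
    intro g g' N hN
    have hNpos : (0 : ℝ) < (N : ℝ) := by exact_mod_cast hN
    rw [← mul_sub, ← Finset.sum_sub_distrib, abs_mul, abs_inv, abs_of_pos hNpos]
    have hb : |∑ k ∈ Finset.range N, (g (U ((k : ℝ≥0) * h) ω) - g' (U ((k : ℝ≥0) * h) ω))| ≤ (N : ℝ) * dist g g' :=
      (Finset.abs_sum_le_sum_abs _ _).trans (by
        calc ∑ k ∈ Finset.range N, |g (U ((k : ℝ≥0) * h) ω) - g' (U ((k : ℝ≥0) * h) ω)| ≤ ∑ _k ∈ Finset.range N, dist g g' :=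
              Finset.sum_le_sum fun k _ => by rw [← Real.dist_eq]; exact g.dist_apply_le_dist _
          _ = (N : ℝ) * dist g g' := by rw [Finset.sum_const, Finset.card_range, nsmul_eq_mul])
    calc (N : ℝ)⁻¹ * |∑ k ∈ Finset.range N, (g (U ((k : ℝ≥0) * h) ω) - g' (U ((k : ℝ≥0) * h) ω))| ≤ (N : ℝ)⁻¹ * ((N : ℝ) * dist g g') :=
          mul_le_mul_of_nonneg_left hb (inv_nonneg.2 hNpos.le)
      _ = dist g g' := by field_simp
  have hgibbs : ∀ (g g' : C(GaugeConfig 3 L (Matrix.specialUnitaryGroup (Fin 2) ℂ), ℝ)), |(∫ z, g z ∂μ) - ∫ z, g' z ∂μ| ≤ dist g g' := by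
    intro g g'
    have hint : ∀ g : C(GaugeConfig 3 L (Matrix.specialUnitaryGroup (Fin 2) ℂ), ℝ), Integrable (fun z => g z) μ := fun g =>
      (integrable_const ‖g‖).mono' g.continuous.measurable.aestronglyMeasurable (Eventually.of_forall fun z => g.norm_coe_le_norm z)
    rw [← integral_sub (hint g) (hint g')]
    have hb := norm_integral_le_of_norm_le_const (μ := μ) (f := fun z => g z - g' z) (C := dist g g')
      (Eventually.of_forall fun z => by rw [← dist_eq_norm]; exact g.dist_apply_le_dist _)
    simpa [Real.norm_eq_abs] using hb
  rw [Metric.tendsto_atTop]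
  intro ε hε
  obtain ⟨g, hgD, hfg⟩ : ∃ g ∈ D, dist f g < ε / 3 := hDd.exists_dist_lt f (by linarith)
  obtain ⟨N₀, hN₀⟩ := (Metric.tendsto_atTop.1 (hωD g hgD)) (ε / 3) (by linarith)
  refine ⟨max N₀ 1, fun N hN => ?_⟩
  have hN1 : 1 ≤ N := (le_max_right _ _).trans hN
  have h1 := havg f g N hN1
  have h2 := hN₀ N ((le_max_left _ _).trans hN)
  have h3 := hgibbs g f
  rw [Real.dist_eq] at h2 ⊢
  rw [dist_comm] at h3
  calc |((N : ℝ)⁻¹ * ∑ k ∈ Finset.range N, f (U ((k : ℝ≥0) * h) ω)) - ∫ z, f z ∂μ|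
      = |(((N : ℝ)⁻¹ * ∑ k ∈ Finset.range N, f (U ((k : ℝ≥0) * h) ω)) - (N : ℝ)⁻¹ * ∑ k ∈ Finset.range N, g (U ((k : ℝ≥0) * h) ω)) +
          (((N : ℝ)⁻¹ * ∑ k ∈ Finset.range N, g (U ((k : ℝ≥0) * h) ω)) - ∫ z, g z ∂μ) + ((∫ z, g z ∂μ) - ∫ z, f z ∂μ)| := by
          congr 1; ring
    _ ≤ |((N : ℝ)⁻¹ * ∑ k ∈ Finset.range N, f (U ((k : ℝ≥0) * h) ω)) - (N : ℝ)⁻¹ * ∑ k ∈ Finset.range N, g (U ((k : ℝ≥0) * h) ω)| +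
          |((N : ℝ)⁻¹ * ∑ k ∈ Finset.range N, g (U ((k : ℝ≥0) * h) ω)) - ∫ z, g z ∂μ| + |(∫ z, g z ∂μ) - ∫ z, f z ∂μ| := abs_add_three _ _ _
    _ < ε / 3 + ε / 3 + ε / 3 := by
        have e1 := lt_of_le_of_lt h1 hfg
        have e3 := lt_of_le_of_lt h3 hfg
        linarith
    _ = ε := by ring

end Summit.QuantumFields.YangMills.Theorems.ColdStartUniversality

end
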